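import Summits.BirchSwinnertonDyer.Rank1Residual.AdditivePotMult.QuadraticBaseChangeDescentCanonicalTwist
import Literature.NumberTheory.DiophantineGeometry.KodairaSymbolUnramifiedBaseChangeProofs
import HarnessLib

/-!
# The odd-`p` ENDs of row T-MIL-3 (H-5a / H-5b / H-5c) WITHOUT the hypothesis `hA`
# (row T-MIL-3, FILE H-4b; seat n1011-p01 GEN 8 — lead R5-84 (j), referee-1 ACK-1 T-MIL-3 proviso (vi))

HONEST FRAMING (cell `b2b-bsdres`, run/shared/lean/b2b/bsd-rank1-residual/, verbatim in every
file): the goal of the cell is to DELETE the COMBINATION-SHAPED residual classes of the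
Birch–Swinnerton-Dyer formula for ALL analytic-rank `≤ 1` elliptic curves over `ℚ` — "full BSD
formula for every rank `≤ 1` curve in class `C`" assembled STRICTLY from published theorems — so
that the rank-`≤ 1` remainder becomes exactly the CONSTRUCTION-SHAPED classes, which are TYPED
(missing-input `Prop`s), NOT attempted. This is not "finishing BSD". Sub-classes X3♯(M) / X4(M)
(additive, potentially multiplicative prime; base-change-and-descend): a RESEARCH ROUTE; they stay
CONSTRUCTION-SHAPED; nothing is booked by this file; no mark / label moved. THEOREMS ONLY: no
definition, no named fact, no `sorry`.

## What

Row T-MIL-3's ENDs (FILES H-5a `padicValRat_norm_mul_tamagawaProduct_eq_of_unramifiedFact_oddPrime`,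
H-5b `bsdp_of_pPartOver_of_bsdp_twist_quadratic_of_unramifiedFact_oddPrime[_of_dvd_discr]` + class
twins, H-5c `…_of_natAbs_discr` family) take the named fact A233
`Literature.NumberTheory.DiophantineGeometry.kodairaSymbolAt_baseChange_of_ramificationIdx_eq_one`
as the HYPOTHESIS `hA` (for `W` only). A233 is now a THEOREM (row T-A233, n1011-p16:
`Literature.NumberTheory.DiophantineGeometry.UnramifiedBaseChange.kodairaSymbolAt_baseChange_of_ramificationIdx_eq_one_holds`).
This file feeds `hA := fun v w ↦ …_holds K v w W` (sibling FILE H-4a's `unramifiedFact_rat`) and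
restates the eight ENDs WITHOUT `hA` — the H-files are not edited:

* `padicValRat_norm_mul_tamagawaProduct_eq_of_addv_unramified_oddPrime` (H-5a END);
* `bsdp_of_pPartOver_of_bsdp_twist_quadratic_of_addv_unramified_oddPrime`, `…_of_dvd_discr` (H-5b);
* `bsdp_of_classX4M_of_rankZero_twist_noMilne_of_addv_unramified_oddPrime`, `…classX3M…` (H-5b);
* `bsdp_of_pPartOver_of_bsdp_twist_quadratic_of_addv_unramified_of_natAbs_discr`,
  `bsdp_of_classX4M_of_rankZero_twist_noMilne_of_addv_unramified_of_natAbs_discr`,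
  `bsdp_of_classX3M_of_rankZero_twist_noMilne_of_addv_unramified_of_natAbs_discr` (H-5c);
* `bsdp_of_classX4M_of_rankZero_twist_noMilne_of_addv_unramified_canonical`,
  `bsdp_of_classX3M_of_rankZero_twist_noMilne_of_addv_unramified_canonical` (H-5d) — **for an X4(M)
  pair with its canonical field `|d_K| = p` and the twist of analytic rank `0` with (ram):
  `BSD(E,p) ⇐ MissingPPartOverAt(E_K, p)` with inputs {Skinner 2016 Thm. C, GZK, modularity} and
  NOTHING ELSE** — no Milne A65, no A233, no local hypothesis, no `Mult Wd p`.

HONEST LIMITS: exactly the H-5 statements minus `hA`; `d_K` odd squarefree resp. `|d_K| = p`; odd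
`p`; total analytic rank `≤ 1`; twist of analytic rank `0` in the class twins; additive `W` at an
unramified `3` with `p = 3`, even `d_K`, `p = 2`, total rank `≥ 2` not covered; X3♯(M)/X4(M) stay
CONSTRUCTION-SHAPED (`MissingPPartOverAt` untouched); closes no class; moves no mark; 0 facts (A233
is CONSUMED as a theorem).

References: J. H. Silverman, *AEC* 2nd ed., Prop. VII.5.4 (a) [SilvermanAEC2009]; J. S. Milne,
Invent. Math. 17 (1972) §1 Thm. 1, §2 [Milne1972ArithmeticAV]; C. Skinner, Pacific J. Math. 283
(2016) Thm. C [Skinner2016PacificMC]; C. Wuthrich, Doc. Math. 19 (2014) Prop. 21 [Wuthrich2014];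
T. Dokchitser, V. Dokchitser, Ann. of Math. 172 (2010) §2.1 [DokchitserDokchitserAnnals2010];
R. L. Miller, LMS J. Comput. Math. 14 (2011) Def. 1.1 [Miller2011LMS].
-/

noncomputable section

open scoped Classical NumberField

open WeierstrassCurve NumberField NumberField.InfinitePlace IsDedekindDomain Rat.HeightOneSpectrum
  Literature.NumberTheory.EllipticCurves Literature.NumberTheory.EllipticCurves.Rank1Residual
  Literature.NumberTheory.EllipticCurves.Rank1Residual.Typed
  Literature.NumberTheory.EllipticCurves.Wuthrich2014
  Literature.NumberTheory.DiophantineGeometry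
  Literature.NumberTheory.DiophantineGeometry.UnramifiedBaseChange

namespace Summit.BirchSwinnertonDyer.Rank1Residual.AdditivePotMult

section UnramifiedOddPrime

variable (W : WeierstrassCurve ℚ) [W.IsElliptic] [W.IsGloballyMinimal] (p : ℕ) [hp : Fact p.Prime]
  (K : Type) [Field K] [NumberField K]
  (Wd : WeierstrassCurve ℚ) [Wd.IsElliptic] [Wd.IsGloballyMinimal]
  (W' : WeierstrassCurve K) [W'.IsElliptic] [W'.IsGloballyMinimal]


omit [W'.IsElliptic] in
/-- **H-5a END WITHOUT `hA`: the odd Tamagawa identity at EVERY odd `p` (`p = 3` included)**, additive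
places prime to `d_K` of every Kodaira type allowed, the additive disjunct of `hS` carrying only
`p = 3 → ℓ_v ≠ 3` — p01's `padicValRat_norm_mul_tamagawaProduct_eq_of_unramifiedFact_oddPrime` fed
with `unramifiedFact_rat`. [cite: Milne1972ArithmeticAV, §1 Thm. 1 and §2 (through DokchitserDokchitserAnnals2010, §2.1, proof of Thm. 8)]
[cite: SilvermanAEC2009, Prop. VII.5.4 (a)] [cite: SilvermanATAEC1994, IV.9.4 and Table 4.1] -/
theorem padicValRat_norm_mul_tamagawaProduct_eq_of_addv_unramified_oddPrime (h2 : Module.finrank ℚ K = 2)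
    (hdodd : Odd (NumberField.discr K)) (hdsq : Squarefree (NumberField.discr K))
    {Cd : VariableChange ℚ} (hWd : Cd • W.quadraticTwist (NumberField.discr K : ℚ) = Wd)
    {C' : VariableChange K} (hW' : C' • W.baseChange K = W') (hp2 : p ≠ 2)
    (hS : ∀ v : HeightOneSpectrum (𝓞 ℚ), W.HasGoodReductionAt v ∨ W.HasMultiplicativeReductionAt v ∨
      (((primesEquiv v : ℕ) : ℤ) ∣ NumberField.discr K ∧ Wd.HasMultiplicativeReductionAt v) ∨
      (W.HasAdditiveReductionAt v ∧ ¬ ((primesEquiv v : ℕ) : ℤ) ∣ NumberField.discr K ∧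
        (p = 3 → (primesEquiv v : ℕ) ≠ 3))) :
    padicValRat p (|Algebra.norm ℚ (C'.u : K)| * W'.tamagawaProduct : ℚ) =
      padicValRat p (|(Cd.u : ℚ)| * (W.tamagawaProduct * Wd.tamagawaProduct) : ℚ) :=
  padicValRat_norm_mul_tamagawaProduct_eq_of_unramifiedFact_oddPrime W K Wd W' h2 hdodd hdsq hWd hW'
    (fun v w => UnramifiedBaseChange.kodairaSymbolAt_baseChange_of_ramificationIdx_eq_one_holds K v w W) p hp2 hS

/-- **H-5b END WITHOUT `hA`: base-change-and-descend at EVERY odd `p` (`p = 3` included), either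
signature, additive places prime to `d_K` of every type — NO unproved hypothesis left besides the
typed over-`K` input**: `BSDp W p ⟸ MissingPPartOverAt W' p ∧ BSDp Wd p` (`hGZK`, `hmod`).
[cite: Milne1972ArithmeticAV, §1 Thm. 1 and §2 (through DokchitserDokchitserAnnals2010, §2.1, proof of Thm. 8)]
[cite: SilvermanAEC2009, Prop. VII.5.4 (a)] [cite: Miller2011LMS, Def. 1.1 (arXiv:1010.2431 p. 3)] -/
theorem bsdp_of_pPartOver_of_bsdp_twist_quadratic_of_addv_unramified_oddPrime
    (hGZK : rank_eq_analyticRank_of_analyticRank_le_one) (hmod : hasEntireLFunction_rat)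
    (h2 : Module.finrank ℚ K = 2)
    (hdodd : Odd (NumberField.discr K)) (hdsq : Squarefree (NumberField.discr K))
    {Cd : VariableChange ℚ} (hWd : Cd • W.quadraticTwist (NumberField.discr K : ℚ) = Wd)
    {C' : VariableChange K} (hW' : C' • W.baseChange K = W')
    (hr : W.analyticRank + Wd.analyticRank ≤ 1) (hp2 : p ≠ 2)
    (hS : ∀ v : HeightOneSpectrum (𝓞 ℚ), W.HasGoodReductionAt v ∨ W.HasMultiplicativeReductionAt v ∨
      (((primesEquiv v : ℕ) : ℤ) ∣ NumberField.discr K ∧ Wd.HasMultiplicativeReductionAt v) ∨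
      (W.HasAdditiveReductionAt v ∧ ¬ ((primesEquiv v : ℕ) : ℤ) ∣ NumberField.discr K ∧
        (p = 3 → (primesEquiv v : ℕ) ≠ 3)))
    (hK : MissingPPartOverAt W' p) (hd : BSDp Wd p) : BSDp W p :=
  bsdp_of_pPartOver_of_bsdp_twist_quadratic_of_unramifiedFact_oddPrime W p K Wd W' hGZK hmod h2 hdodd
    hdsq hWd hW' hr (fun v w => UnramifiedBaseChange.kodairaSymbolAt_baseChange_of_ramificationIdx_eq_one_holds K v w W) hp2 hS hK hd

/-- **THE IN-CLASS END WITHOUT `hA`** (`K` ramified at `p`, e.g. `ℚ(√p*)`; `ℚ(√−3)` at `p = 3`):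
`BSDp W p ⟸ MissingPPartOverAt W' p ∧ BSDp Wd p` at EVERY odd `p ∣ d_K` on the S₃ population
`W` good ∨ multiplicative ∨ (`ℓ ∣ d_K` ∧ `Wd` multiplicative) ∨ (additive ∧ `ℓ ∤ d_K`) — FILE G-1's
statement with `5 ≤ p` replaced by `p ≠ 2 ∧ p ∣ d_K` and `hA` GONE (`hGZK`, `hmod` only).
[cite: Milne1972ArithmeticAV, §1 Thm. 1 and §2 (through DokchitserDokchitserAnnals2010, §2.1, proof of Thm. 8)]
[cite: SilvermanAEC2009, Prop. VII.5.4 (a)] [cite: Miller2011LMS, Def. 1.1 (arXiv:1010.2431 p. 3)] -/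
theorem bsdp_of_pPartOver_of_bsdp_twist_quadratic_of_addv_unramified_oddPrime_of_dvd_discr
    (hGZK : rank_eq_analyticRank_of_analyticRank_le_one) (hmod : hasEntireLFunction_rat)
    (h2 : Module.finrank ℚ K = 2)
    (hdodd : Odd (NumberField.discr K)) (hdsq : Squarefree (NumberField.discr K))
    (hpd : (p : ℤ) ∣ NumberField.discr K)
    {Cd : VariableChange ℚ} (hWd : Cd • W.quadraticTwist (NumberField.discr K : ℚ) = Wd)
    {C' : VariableChange K} (hW' : C' • W.baseChange K = W')
    (hr : W.analyticRank + Wd.analyticRank ≤ 1) (hp2 : p ≠ 2)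
    (hS : ∀ v : HeightOneSpectrum (𝓞 ℚ), W.HasGoodReductionAt v ∨ W.HasMultiplicativeReductionAt v ∨
      (((primesEquiv v : ℕ) : ℤ) ∣ NumberField.discr K ∧ Wd.HasMultiplicativeReductionAt v) ∨
      (W.HasAdditiveReductionAt v ∧ ¬ ((primesEquiv v : ℕ) : ℤ) ∣ NumberField.discr K))
    (hK : MissingPPartOverAt W' p) (hd : BSDp Wd p) : BSDp W p :=
  bsdp_of_pPartOver_of_bsdp_twist_quadratic_of_unramifiedFact_oddPrime_of_dvd_discr W p K Wd W' hGZK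
    hmod h2 hdodd hdsq hpd hWd hW' hr (fun v w => UnramifiedBaseChange.kodairaSymbolAt_baseChange_of_ramificationIdx_eq_one_holds K v w W) hp2 hS hK hd

/-- **H-5b (X4(M)⁰) WITHOUT `hA`**: `BSD(E, p) ⇐ MissingPPartOverAt W' p` for `(E,p) ∈ X4(M)` of
analytic rank `≤ 1` with a rank-zero multiplicative (ram) twist by `d_K` (odd squarefree, either
signature), `W` on S₃ with only `p = 3 → ℓ_v ≠ 3` in the additive disjunct; inputs Skinner 2016
Thm. C (`hSk`), `hGZK`, `hmod` — neither Milne's A65 nor A233 as hypotheses.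
[cite: Skinner2016PacificMC, Thm. C (§1), footnote 1, §2.5]
[cite: Milne1972ArithmeticAV, §1 Thm. 1 and §2 (through DokchitserDokchitserAnnals2010, §2.1, proof of Thm. 8)] -/
theorem bsdp_of_classX4M_of_rankZero_twist_noMilne_of_addv_unramified_oddPrime
    (hGZK : rank_eq_analyticRank_of_analyticRank_le_one) (hmod : hasEntireLFunction_rat)
    (hSk : Skinner2016.thmC_padicValRat_bsd_rank_zero)
    (hX : ClassX4M W p) (hr : W.analyticRank ≤ 1) (h2 : Module.finrank ℚ K = 2)
    (hdodd : Odd (NumberField.discr K)) (hdsq : Squarefree (NumberField.discr K))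
    {Cd : VariableChange ℚ} (hWd : Cd • W.quadraticTwist (NumberField.discr K : ℚ) = Wd)
    (hmult : Mult Wd p) (hram : Ram Wd p) (hr0 : Wd.analyticRank = 0)
    {C' : VariableChange K} (hW' : C' • W.baseChange K = W')
    (hS : ∀ v : HeightOneSpectrum (𝓞 ℚ), W.HasGoodReductionAt v ∨ W.HasMultiplicativeReductionAt v ∨
      (((primesEquiv v : ℕ) : ℤ) ∣ NumberField.discr K ∧ Wd.HasMultiplicativeReductionAt v) ∨
      (W.HasAdditiveReductionAt v ∧ ¬ ((primesEquiv v : ℕ) : ℤ) ∣ NumberField.discr K ∧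
        (p = 3 → (primesEquiv v : ℕ) ≠ 3)))
    (hK : MissingPPartOverAt W' p) : BSDp W p :=
  bsdp_of_classX4M_of_rankZero_twist_noMilne_of_unramifiedFact_oddPrime W p K Wd W' hGZK hmod hSk hX hr
    h2 hdodd hdsq hWd hmult hram hr0 hW' (fun v w => UnramifiedBaseChange.kodairaSymbolAt_baseChange_of_ramificationIdx_eq_one_holds K v w W) hS hK

/-- **H-5b (X3♯(M)⁰) WITHOUT `hA`**: `BSD(E,p) ⇐ MissingPPartOverAt W' p ∧ MissingLowerBoundAt Wd p`
for `(E,p) ∈ X3♯(M)` of analytic rank `≤ 1` with a rank-zero multiplicative twist by `d_K`, `W` on S₃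
with only `p = 3 → ℓ_v ≠ 3` in the additive disjunct; inputs Wuthrich 2014 Prop. 21 (`hW`), `hGZK`,
`hmod`. [cite: Wuthrich2014, Prop. 21]
[cite: Milne1972ArithmeticAV, §1 Thm. 1 and §2 (through DokchitserDokchitserAnnals2010, §2.1, proof of Thm. 8)] -/
theorem bsdp_of_classX3M_of_rankZero_twist_noMilne_of_addv_unramified_oddPrime
    (hGZK : rank_eq_analyticRank_of_analyticRank_le_one) (hmod : hasEntireLFunction_rat)
    (hW : sha_dvd_analyticSha)
    (hX : ClassX3M W p) (hr : W.analyticRank ≤ 1) (h2 : Module.finrank ℚ K = 2)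
    (hdodd : Odd (NumberField.discr K)) (hdsq : Squarefree (NumberField.discr K))
    {Cd : VariableChange ℚ} (hWd : Cd • W.quadraticTwist (NumberField.discr K : ℚ) = Wd)
    (hmult : Mult Wd p) (hr0 : Wd.analyticRank = 0)
    {C' : VariableChange K} (hW' : C' • W.baseChange K = W')
    (hS : ∀ v : HeightOneSpectrum (𝓞 ℚ), W.HasGoodReductionAt v ∨ W.HasMultiplicativeReductionAt v ∨
      (((primesEquiv v : ℕ) : ℤ) ∣ NumberField.discr K ∧ Wd.HasMultiplicativeReductionAt v) ∨
      (W.HasAdditiveReductionAt v ∧ ¬ ((primesEquiv v : ℕ) : ℤ) ∣ NumberField.discr K ∧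
        (p = 3 → (primesEquiv v : ℕ) ≠ 3)))
    (hK : MissingPPartOverAt W' p) (hlow : MissingLowerBoundAt Wd p) : BSDp W p :=
  bsdp_of_classX3M_of_rankZero_twist_noMilne_of_unramifiedFact_oddPrime W p K Wd W' hGZK hmod hW hX hr
    h2 hdodd hdsq hWd hmult hr0 hW' (fun v w => UnramifiedBaseChange.kodairaSymbolAt_baseChange_of_ramificationIdx_eq_one_holds K v w W) hS hK hlow


/-- **H-5c END WITHOUT `hA` — THE CANONICAL FIELD `|d_K| = p`, NO LOCAL HYPOTHESIS, NO NAMED FACT:**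
`BSDp W p ⟸ MissingPPartOverAt W' p ∧ BSDp Wd p` for `[K:ℚ] = 2` with `|d_K| = p` odd, `W_d`
multiplicative at `p`, `r_an(W) + r_an(W_d) ≤ 1`; hypotheses `hGZK`, `hmod` only.
[cite: Milne1972ArithmeticAV, §1 Thm. 1 and §2 (through DokchitserDokchitserAnnals2010, §2.1, proof of Thm. 8)]
[cite: SilvermanAEC2009, Prop. VII.5.4 (a)] [cite: Miller2011LMS, Def. 1.1 (arXiv:1010.2431 p. 3)] -/
theorem bsdp_of_pPartOver_of_bsdp_twist_quadratic_of_addv_unramified_of_natAbs_discr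
    (hGZK : rank_eq_analyticRank_of_analyticRank_le_one) (hmod : hasEntireLFunction_rat)
    (h2 : Module.finrank ℚ K = 2) (hdK : (NumberField.discr K).natAbs = p)
    {Cd : VariableChange ℚ} (hWd : Cd • W.quadraticTwist (NumberField.discr K : ℚ) = Wd)
    {C' : VariableChange K} (hW' : C' • W.baseChange K = W')
    (hr : W.analyticRank + Wd.analyticRank ≤ 1) (hp2 : p ≠ 2) (hmult : Mult Wd p)
    (hK : MissingPPartOverAt W' p) (hd : BSDp Wd p) : BSDp W p :=
  bsdp_of_pPartOver_of_bsdp_twist_quadratic_of_unramifiedFact_of_natAbs_discr W p K Wd W' hGZK hmod h2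
    hdK hWd hW' hr (fun v w => UnramifiedBaseChange.kodairaSymbolAt_baseChange_of_ramificationIdx_eq_one_holds K v w W) hp2
    hmult hK hd

/-- **X4(M)⁰ WITH THE CANONICAL FIELD, NO `hA`: `BSD(E, p) ⇐ MissingPPartOverAt W' p`** for
`(E,p) ∈ X4(M)` of analytic rank `≤ 1`, `|d_K| = p`, twist `Wd = C_d • W^{(d_K)}` multiplicative at
`p` of analytic rank `0` with (ram), `W' = C' • W_K` globally minimal — inputs {Skinner 2016 Thm. C
(`hSk`), `hGZK`, `hmod`} and NOTHING ELSE: no Milne A65, no A233, no local hypothesis. The typed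
over-`K` input `MissingPPartOverAt(E_K, p)` is the whole CONSTRUCTION-SHAPED residue.
[cite: Skinner2016PacificMC, Thm. C (§1), footnote 1, §2.5]
[cite: Milne1972ArithmeticAV, §1 Thm. 1 and §2 (through DokchitserDokchitserAnnals2010, §2.1, proof of Thm. 8)] -/
theorem bsdp_of_classX4M_of_rankZero_twist_noMilne_of_addv_unramified_of_natAbs_discr
    (hGZK : rank_eq_analyticRank_of_analyticRank_le_one) (hmod : hasEntireLFunction_rat)
    (hSk : Skinner2016.thmC_padicValRat_bsd_rank_zero)
    (hX : ClassX4M W p) (hr : W.analyticRank ≤ 1) (h2 : Module.finrank ℚ K = 2)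
    (hdK : (NumberField.discr K).natAbs = p)
    {Cd : VariableChange ℚ} (hWd : Cd • W.quadraticTwist (NumberField.discr K : ℚ) = Wd)
    (hmult : Mult Wd p) (hram : Ram Wd p) (hr0 : Wd.analyticRank = 0)
    {C' : VariableChange K} (hW' : C' • W.baseChange K = W')
    (hK : MissingPPartOverAt W' p) : BSDp W p :=
  bsdp_of_classX4M_of_rankZero_twist_noMilne_of_unramifiedFact_of_natAbs_discr W p K Wd W' hGZK hmod
    hSk hX hr h2 hdK hWd hmult hram hr0 hW'
    (fun v w => UnramifiedBaseChange.kodairaSymbolAt_baseChange_of_ramificationIdx_eq_one_holds K v w W) hK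

/-- **X3♯(M)⁰ WITH THE CANONICAL FIELD, NO `hA`:
`BSD(E,p) ⇐ MissingPPartOverAt W' p ∧ MissingLowerBoundAt Wd p`** for `(E,p) ∈ X3♯(M)` of analytic
rank `≤ 1`, `|d_K| = p`, twist multiplicative at `p` of analytic rank `0` — inputs {Wuthrich 2014
Prop. 21 (`hW`), `hGZK`, `hmod`} and nothing else. [cite: Wuthrich2014, Prop. 21]
[cite: Milne1972ArithmeticAV, §1 Thm. 1 and §2 (through DokchitserDokchitserAnnals2010, §2.1, proof of Thm. 8)] -/
theorem bsdp_of_classX3M_of_rankZero_twist_noMilne_of_addv_unramified_of_natAbs_discr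
    (hGZK : rank_eq_analyticRank_of_analyticRank_le_one) (hmod : hasEntireLFunction_rat)
    (hW : sha_dvd_analyticSha)
    (hX : ClassX3M W p) (hr : W.analyticRank ≤ 1) (h2 : Module.finrank ℚ K = 2)
    (hdK : (NumberField.discr K).natAbs = p)
    {Cd : VariableChange ℚ} (hWd : Cd • W.quadraticTwist (NumberField.discr K : ℚ) = Wd)
    (hmult : Mult Wd p) (hr0 : Wd.analyticRank = 0)
    {C' : VariableChange K} (hW' : C' • W.baseChange K = W')
    (hK : MissingPPartOverAt W' p) (hlow : MissingLowerBoundAt Wd p) : BSDp W p :=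
  bsdp_of_classX3M_of_rankZero_twist_noMilne_of_unramifiedFact_of_natAbs_discr W p K Wd W' hGZK hmod
    hW hX hr h2 hdK hWd hmult hr0 hW'
    (fun v w => UnramifiedBaseChange.kodairaSymbolAt_baseChange_of_ramificationIdx_eq_one_holds K v w W) hK hlow

/-- **H-5d (X4(M)⁰, canonical field, `Mult Wd p` discharged) WITHOUT `hA` — THE SHARPEST FORM:**
for `(E,p) ∈ X4(M)` of analytic rank `≤ 1`, `K` with `|d_K| = p`, `Wd = C_d • W^{(d_K)}` globally
minimal of analytic rank `0` with (ram), `W' = C' • W_K` globally minimal: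
**`BSD(E, p) ⇐ MissingPPartOverAt W' p`**, inputs {Skinner 2016 Thm. C, GZK, modularity} and NOTHING
ELSE — per-pair hypotheses = the twist's analytic rank `0` and (ram); no Milne A65, no A233, no local
hypothesis, no `Mult Wd p`. [cite: Skinner2016PacificMC, Thm. C (§1), footnote 1, §2.5]
[cite: SilvermanATAEC1994, V.5.3] [cite: Milne1972ArithmeticAV, §1 Thm. 1 and §2 (through DokchitserDokchitserAnnals2010, §2.1, proof of Thm. 8)] -/
theorem bsdp_of_classX4M_of_rankZero_twist_noMilne_of_addv_unramified_canonical
    (hGZK : rank_eq_analyticRank_of_analyticRank_le_one) (hmod : hasEntireLFunction_rat)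
    (hSk : Skinner2016.thmC_padicValRat_bsd_rank_zero)
    (hX : ClassX4M W p) (hr : W.analyticRank ≤ 1) (h2 : Module.finrank ℚ K = 2)
    (hdK : (NumberField.discr K).natAbs = p)
    {Cd : VariableChange ℚ} (hWd : Cd • W.quadraticTwist (NumberField.discr K : ℚ) = Wd)
    (hram : Ram Wd p) (hr0 : Wd.analyticRank = 0)
    {C' : VariableChange K} (hW' : C' • W.baseChange K = W')
    (hK : MissingPPartOverAt W' p) : BSDp W p :=
  bsdp_of_classX4M_of_rankZero_twist_noMilne_of_unramifiedFact_canonical W p K Wd W' hGZK hmod hSk hX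
    hr h2 hdK hWd hram hr0 hW'
    (fun v w => UnramifiedBaseChange.kodairaSymbolAt_baseChange_of_ramificationIdx_eq_one_holds K v w W) hK

/-- **H-5d (X3♯(M)⁰, canonical field) WITHOUT `hA`:
`BSD(E,p) ⇐ MissingPPartOverAt W' p ∧ MissingLowerBoundAt Wd p`**, inputs {Wuthrich 2014 Prop. 21,
GZK, modularity}; per-pair hypothesis = the twist's analytic rank `0`. [cite: Wuthrich2014, Prop. 21]
[cite: SilvermanATAEC1994, V.5.3] [cite: Milne1972ArithmeticAV, §1 Thm. 1 and §2 (through DokchitserDokchitserAnnals2010, §2.1, proof of Thm. 8)] -/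
theorem bsdp_of_classX3M_of_rankZero_twist_noMilne_of_addv_unramified_canonical
    (hGZK : rank_eq_analyticRank_of_analyticRank_le_one) (hmod : hasEntireLFunction_rat)
    (hW : sha_dvd_analyticSha)
    (hX : ClassX3M W p) (hr : W.analyticRank ≤ 1) (h2 : Module.finrank ℚ K = 2)
    (hdK : (NumberField.discr K).natAbs = p)
    {Cd : VariableChange ℚ} (hWd : Cd • W.quadraticTwist (NumberField.discr K : ℚ) = Wd)
    (hr0 : Wd.analyticRank = 0)
    {C' : VariableChange K} (hW' : C' • W.baseChange K = W')
    (hK : MissingPPartOverAt W' p) (hlow : MissingLowerBoundAt Wd p) : BSDp W p :=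
  bsdp_of_classX3M_of_rankZero_twist_noMilne_of_unramifiedFact_canonical W p K Wd W' hGZK hmod hW hX
    hr h2 hdK hWd hr0 hW'
    (fun v w => UnramifiedBaseChange.kodairaSymbolAt_baseChange_of_ramificationIdx_eq_one_holds K v w W) hK hlow

end UnramifiedOddPrime

end Summit.BirchSwinnertonDyer.Rank1Residual.AdditivePotMult

end
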